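import Summits.Ventures.HSemireg.ParitySieveTwoFactor
import HarnessLib

/-!
# Venture HSemireg — THEOREM (B-XIX)(c)(d) AT n = 4 (g = 8, family B): the MENU LAW «the σ-frame class of a family-B menu passes the
# two-factor sieve ⟺ B ≡ C ≡ d·rk (mod 2)», unchanged by any twist `e^{aΘ_x + bΘ_y}`, and the BOX READINGS of the border sieve —
# kernel statements over `ℤ` (residues by `decide` over `ZMod 2`)

HONEST FRAMING. Part of the Lean index of the computation cell `pub-hsemireg` (Sunday typer seat p9, § g = 8; census row **B19-21**;
third part of the (B-XIX) port after `ParitySieveOneFactor.lean` ∕ `ParitySieveTwoFactor.lean`, whose `sieve ∕ pe ∕ po ∕ expPow ∕ border ∕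
tensor ∕ twist1 ∕ twist2` are used). FINITE ARITHMETIC ONLY; no variety, sheaf or semiregularity map is constructed; the hypothesis (I1)
([EdGFS25], PREPRINT) is NOT a binder of any theorem here; nothing here says that HC ∕ HC_CM ∕ HC_AV holds; no object is certified; no
Literature fact is declared. The census's cross-tabulation «196 of the 255 W-alive count-feasible menus FAIL» is NOT recomputed here
(the menu table is engine data; `CensusG8Table.lean` row B19-21 carries the words) — this file proves the LAW the table instantiates.

TEXTS OF RECORD (quoted, not interpreted). Source: t-19 g7, `target-g8/BISECANT-G8-t19g7.md` v1.3 `68df8c98ce5a70b7` §2 (c)(d); census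
row B19-21 of `target-g8/CENSUS.md` v1.274 `7744dc4867915f69`; t-19 g7's folder-local `TwoFactorSieve.lean` `1f2b1f702b73cbf4`
(`menuLaw_mod2`, `boxCells_fail`).
* (B-XIX)(c) MENU LAW: «For the class c(d, rk, B, C, D) of §0.5 (the σ-frame class of every family-B menu (d,rk,B,C,D,a,b), g3 §1;
  LEMMA M: c ∈ ℤ⟨u_ij⟩) [= rk·pe⊗pe + B·pe⊗po + C·po⊗pe + D·po⊗po, pe(d) = Σ_{i even}(−d)^{i∕2}u_i, po(d) = Σ_{i odd}(−d)^{(i−1)∕2}u_i]: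
  column 0 = rk·pe + C·po = (rk, C, −d·rk, −dC, d²rk, …), row 0 = rk·pe + B·po, column n = (−d)^{n∕2}·column 0 and row n likewise
  for n even … At n = 4: c̄ ∈ S₄ ⟺ C ≡ d·rk ≡ dC and B ≡ d·rk ≡ dB (mod 2) ⟺ B ≡ C ≡ d·rk (mod 2) (case check: rk odd ⇒ B ≡ C ≡ d;
  rk even ⇒ B ≡ C ≡ 0). Twists (a,b) and Φ-images do not change the verdict (S₄ is stable). MACHINE: … n = 4, 6, 8: pass ⟺
  B ≡ C ≡ d·rk; … 0 exceptions».
* (B-XIX)(d), last paragraph: «For boxes F₁ ⊠ F₂ with rk F₂ odd the two-factor sieve gives it directly (column 0 = rk(F₂)·v(F₁)); for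
  rank-0 ⊠ rank-0 boxes S₄ is blind (all four border lines vanish) and LEMMA K is needed».

WHAT THIS FILE PROVES (kernel). `menuClass d rk B C D` (the untwisted σ-frame class on `ℤ^{5×5}`), its four border lines
(`col_menuClass_zero` … `row_menuClass_four`), **`menuLaw`**: `border (menuClass d rk B C D) ↔ (B − d·rk) % 2 = 0 ∧ (C − d·rk) % 2 = 0`
(`D` and the interior invisible; the sixteen residue patterns of `(d, rk, B, C)` by `decide` over `ZMod 2` — t-19 g7's `menuLaw_mod2` is
the residue statement), `menuLaw_cases` (rk odd ∕ even), **`menuLaw_twisted`** (the same after any twist `e^{aΘ_x} ⊗ e^{bΘ_y}`, by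
`border_twist1_iff` ∕ `border_twist2_iff`), `menuLaw_Phi1` ∕ `menuLaw_Phi2` (Φ-images), and `menuLaw_census_instances` (the
residual-OPEN menus of the text pass, a «sieve-FAIL» representative and the `ℚ(i)` rank-1 box class fail — kernel `decide` controls). Box readings: `border_tensor_iff`,
`sieve_of_border_tensor_odd` (odd-rank second factor ⇒ first factor sieved), `border_tensor_of_even_ends` (the sieve is BLIND on
rank-0-type ⊠ rank-0-type boxes, as the text says), `not_border_boxCell_tensor_odd` (the `d = 1` cells).

WHAT IS NOT HERE. The 255-menu table and its FAIL ∕ FLAG counts; LEMMA K; the dictionary; n ≥ 5. Everything here is at n = 4 only.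
-/

namespace Summit.Ventures.HSemireg.ParitySieve

section MenuLaw

variable (v w : Fin 5 → Fin 5 → ℤ) (n x y : Fin 5 → ℤ)

/-! ## §3 The MENU LAW at n = 4 ((B-XIX)(c)) -/

/-- The σ-frame class of a family-B menu `(d, rk, B, C, D, a, b)` before twisting: `c = rk·pe⊗pe + B·pe⊗po + C·po⊗pe + D·po⊗po`.
[bookkeeping; transcription of (B-XIX)(c)] -/
def menuClass (d rk B C D : ℤ) : Fin 5 → Fin 5 → ℤ :=
  rk • tensor (pe d) (pe d) + B • tensor (pe d) (po d) + C • tensor (po d) (pe d) + D • tensor (po d) (po d)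

/-- Column 0 of the menu class is `(rk, C, −d·rk, −dC, d²rk)` («hand at n = 4»). [bookkeeping] -/
theorem col_menuClass_zero (d rk B C D : ℤ) :
    col (menuClass d rk B C D) 0 = ![rk, C, -d * rk, -d * C, d ^ 2 * rk] := by
  funext i
  fin_cases i <;> simp [col, menuClass, tensor, pe, po] <;> ring

/-- Row 0 of the menu class is `(rk, B, −d·rk, −dB, d²rk)`. [bookkeeping] -/
theorem row_menuClass_zero (d rk B C D : ℤ) :
    row (menuClass d rk B C D) 0 = ![rk, B, -d * rk, -d * B, d ^ 2 * rk] := by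
  funext j
  fin_cases j <;> simp [row, menuClass, tensor, pe, po] <;> ring

/-- Column 4 = `d²·`column 0. [bookkeeping] -/
theorem col_menuClass_four (d rk B C D : ℤ) :
    col (menuClass d rk B C D) 4 = (d ^ 2) • col (menuClass d rk B C D) 0 := by
  funext i
  fin_cases i <;> simp [col, menuClass, tensor, pe, po] <;> ring

/-- Row 4 = `d²·`row 0. [bookkeeping] -/
theorem row_menuClass_four (d rk B C D : ℤ) :
    row (menuClass d rk B C D) 4 = (d ^ 2) • row (menuClass d rk B C D) 0 := by
  funext j
  fin_cases j <;> simp [row, menuClass, tensor, pe, po] <;> ring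

/-- Residue form of `menuLaw` (t-19 g7's `menuLaw_mod2` shape), all 2⁴ residue patterns of `(d, rk, B, C)`. [bookkeeping] -/
private theorem menuLaw_aux : ∀ d rk B C : ZMod 2,
    (((C = -d * rk ∧ -d * rk = -d * C) ∧ (d ^ 2 * C = d ^ 2 * (-d * rk) ∧ d ^ 2 * (-d * rk) = d ^ 2 * (-d * C)) ∧
        (B = -d * rk ∧ -d * rk = -d * B) ∧ (d ^ 2 * B = d ^ 2 * (-d * rk) ∧ d ^ 2 * (-d * rk) = d ^ 2 * (-d * B))) ↔
      (B = d * rk ∧ C = d * rk)) := by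
  decide

/-- **MENU LAW at n = 4, over `ℤ`:** the menu class passes the border sieve iff `B ≡ d·rk` and `C ≡ d·rk (mod 2)` («⟺ B ≡ C ≡ d·rk
(mod 2) for n ∈ {4,6,8}»; `D` and the interior are invisible). With `border_T1_iff … border_twist2` the verdict is unchanged by any
twist `e^{aΘ_x + bΘ_y}` and any `Φ`-image, as the text states. Proof: the four border lines by `col_menuClass_zero` …
`row_menuClass_four`, then the sixteen residue patterns of `(d, rk, B, C)` by `decide` over `ZMod 2` (t-19 g7's `menuLaw_mod2` is the
residue statement). [bookkeeping; kernel form of (B-XIX)(c) at n = 4] -/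
theorem menuLaw (d rk B C D : ℤ) :
    border (menuClass d rk B C D) ↔ ((B - d * rk) % 2 = 0 ∧ (C - d * rk) % 2 = 0) := by
  rw [border, col_menuClass_four, row_menuClass_four, col_menuClass_zero, row_menuClass_zero]
  simp only [sieve_iff_cast, emod_two_sub_iff, Pi.smul_apply, smul_eq_mul, Matrix.cons_val_zero, Matrix.cons_val_one,
    Matrix.head_cons, Matrix.cons_val_two, Matrix.tail_cons, Matrix.cons_val_three]
  push_cast
  exact menuLaw_aux _ _ _ _

/-- The menu law's two cases spelled out («rk odd ⇒ B ≡ C ≡ d; rk even ⇒ B ≡ C ≡ 0»). [bookkeeping] -/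
theorem menuLaw_cases (d rk B C D : ℤ) :
    (rk % 2 = 1 → (border (menuClass d rk B C D) ↔ ((B - d) % 2 = 0 ∧ (C - d) % 2 = 0))) ∧
    (rk % 2 = 0 → (border (menuClass d rk B C D) ↔ (B % 2 = 0 ∧ C % 2 = 0))) := by
  constructor
  · intro hrk
    rw [menuLaw, emod_two_sub_iff, emod_two_sub_iff, emod_two_sub_iff, emod_two_sub_iff]
    push_cast
    rw [cast_eq_one_of_emod_two rk hrk, mul_one]
  · intro hrk
    rw [menuLaw, emod_two_sub_iff, emod_two_sub_iff, emod_two_eq_zero_iff_cast B, emod_two_eq_zero_iff_cast C]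
    push_cast
    rw [(emod_two_eq_zero_iff_cast rk).mp hrk, mul_zero]

/-- **MENU LAW after any twist `e^{aΘ_x + bΘ_y}`** («Twists (a,b) … do not change the verdict»): the twisted menu class
`e^{aΘ_x} ⋆₁ (e^{bΘ_y} ⋆₂ c)` passes the border sieve iff `B ≡ d·rk` and `C ≡ d·rk (mod 2)`. [bookkeeping] -/
theorem menuLaw_twisted (a b d rk B C D : ℤ) :
    border (twist1 (expPow a) (twist2 (expPow b) (menuClass d rk B C D))) ↔
      ((B - d * rk) % 2 = 0 ∧ (C - d * rk) % 2 = 0) := by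
  have ha : (expPow a) 0 % 2 = 1 := by simp [expPow]
  have hb : (expPow b) 0 % 2 = 1 := by simp [expPow]
  rw [border_twist1_iff _ _ (sieve_expPow a) ha, border_twist2_iff _ _ (sieve_expPow b) hb, menuLaw]

/-- **MENU LAW after a relative Fourier–Mukai `Φ₁`** («Φ-images do not change the verdict»). [bookkeeping] -/
theorem menuLaw_Phi1 (d rk B C D : ℤ) :
    border (Phi1 (menuClass d rk B C D)) ↔ ((B - d * rk) % 2 = 0 ∧ (C - d * rk) % 2 = 0) := by
  rw [border_Phi1_iff, menuLaw]

/-- **MENU LAW after `Φ₂`.** [bookkeeping] -/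
theorem menuLaw_Phi2 (d rk B C D : ℤ) :
    border (Phi2 (menuClass d rk B C D)) ↔ ((B - d * rk) % 2 = 0 ∧ (C - d * rk) % 2 = 0) := by
  rw [border_Phi2_iff, menuLaw]

/-- **Census instances (kernel `decide` on the integers of record).** The residual-OPEN menus of BISECANT-G8-t19g7.md §0∕§5 pass the
sieve — S2 `(d, rk, B, C, D) = (2, 1, 0, 0, −1)` and `(2, 1, 0, 0, 0)`, the `(3, 1, 1, 1, D)` trio, the untwisted `D = 2` trio
`(d, 0, 0, 0, 2)` — while a representative of the «10 sieve-FAIL (3,1,0,0,0,a,b)» menus and the `ℚ(i)` box-cell rank-1 class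
`(1, 1, 0, 0, 0)` (= pe(1) ⊗ pe(1)) FAIL, exactly as `menuLaw` predicts (B ≡ C ≡ d·rk). [bookkeeping; negative∕positive controls] -/
theorem menuLaw_census_instances :
    border (menuClass 2 1 0 0 (-1)) ∧ border (menuClass 2 1 0 0 0) ∧ border (menuClass 3 1 1 1 (-1)) ∧
      border (menuClass 3 1 1 1 0) ∧ border (menuClass 3 1 1 1 1) ∧ border (menuClass 1 0 0 0 2) ∧ border (menuClass 3 0 0 0 2) ∧
      ¬ border (menuClass 3 1 0 0 0) ∧ ¬ border (menuClass 1 1 0 0 0) := by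
  refine ⟨?_, ?_, ?_, ?_, ?_, ?_, ?_, ?_, ?_⟩ <;> rw [menuLaw] <;> decide

/-- **Cross-check against the machine table of record** (t-19 g7 `runs/sieve2.json` `33e1613f5474fb01`, key `menus_n4.open22`): the
recorded class of the S2 menu `(2,1,0,0,−1,0,0)` is «+1·u00 −2·u02 +4·u04 −1·u11 +2·u13 −2·u20 +4·u22 −8·u24 +2·u31 −4·u33 +4·u40 −8·u42
+16·u44» — equal, entry by entry, to `menuClass 2 1 0 0 (−1)` (so the `(d, rk, B, C, D)` reading of this file is the table's).
[bookkeeping; ×2 datum Lean ∣ python] -/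
theorem menuClass_record_S2 :
    menuClass 2 1 0 0 (-1) =
      ![![1, 0, -2, 0, 4], ![0, -1, 0, 2, 0], ![-2, 0, 4, 0, -8], ![0, 2, 0, -4, 0], ![4, 0, -8, 0, 16]] := by
  funext i j
  fin_cases i <;> fin_cases j <;> simp [menuClass, tensor, pe, po]

/-! ## §4 Box readings of the two-factor sieve ((B-XIX)(d), last paragraph) -/

/-- The border lines of a box `x ⊗ y`: column 0 = `y₀·x`, column 4 = `y₄·x`, row 0 = `x₀·y`, row 4 = `x₄·y`. [bookkeeping] -/
theorem border_tensor_iff :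
    border (tensor x y) ↔ (sieve (y 0 • x) ∧ sieve (y 4 • x) ∧ sieve (x 0 • y) ∧ sieve (x 4 • y)) := by
  have e1 : col (tensor x y) 0 = y 0 • x := by funext i; simp [col, tensor, mul_comm]
  have e2 : col (tensor x y) 4 = y 4 • x := by funext i; simp [col, tensor, mul_comm]
  have e3 : row (tensor x y) 0 = x 0 • y := by funext j; simp [row, tensor]
  have e4 : row (tensor x y) 4 = x 4 • y := by funext j; simp [row, tensor]
  rw [border, e1, e2, e3, e4]


/-- **«For boxes F₁ ⊠ F₂ with rk F₂ odd the two-factor sieve gives it directly (column 0 = rk(F₂)·v(F₁))»:** if `y₀` is odd, the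
box `x ⊗ y` passes the border sieve only if `x` is sieved. [bookkeeping; kernel form of a sentence of (B-XIX)(d)] -/
theorem sieve_of_border_tensor_odd (hy : y 0 % 2 = 1) (h : border (tensor x y)) : sieve x := by
  rw [border_tensor_iff] at h
  exact (sieve_smul_iff_of_odd x (y 0) hy).mp h.1

/-- **«For rank-0 ⊠ rank-0 boxes S₄ is blind (all four border lines vanish)»:** if `x₀, x₄, y₀, y₄` are all even (e.g. both
factors of `po`-type: rank `0` and `ch₄ = 0`), the box `x ⊗ y` passes the border sieve whatever the other entries — the honest limit
of the sieve recorded in the text (LEMMA K is needed there).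
[bookkeeping; kernel form of a sentence of (B-XIX)(d)] -/
theorem border_tensor_of_even_ends (hx0 : x 0 % 2 = 0) (hx4 : x 4 % 2 = 0) (hy0 : y 0 % 2 = 0) (hy4 : y 4 % 2 = 0) :
    border (tensor x y) := by
  rw [border_tensor_iff]
  simp only [sieve_iff_cast, Pi.smul_apply, smul_eq_mul, emod_two_eq_zero_iff_cast] at hx0 hx4 hy0 hy4 ⊢
  push_cast
  simp [hx0, hx4, hy0, hy4]

/-- The two `ℚ(i)` box cells of the census at `d = 1` in the two-factor reading: a box `pe(1) ⊗ y` with `y₀` odd, or `po(1) ⊗ y`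
with `y₀` odd, FAILS the border sieve (t-19 g7 `boxCells_fail` + the odd-rank box reading). [bookkeeping] -/
theorem not_border_boxCell_tensor_odd (hy : y 0 % 2 = 1) :
    ¬ border (tensor (pe 1) y) ∧ ¬ border (tensor (po 1) y) :=
  ⟨fun h => boxCells_d_one.1 (sieve_of_border_tensor_odd _ _ hy h),
    fun h => boxCells_d_one.2 (sieve_of_border_tensor_odd _ _ hy h)⟩

end MenuLaw

end Summit.Ventures.HSemireg.ParitySieve
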